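import Summits.BirchSwinnertonDyer.BirchSwinnertonDyer.Theses.PAdicOrderV2
import Literature.NumberTheory.EllipticCurves.PAdicGrossZagier
import Literature.NumberTheory.EllipticCurves.PAdicGrossZagierConstantTermProofs
import Literature.NumberTheory.EllipticCurves.AnalyticRankOrderProofs
import Literature.NumberTheory.EllipticCurves.CuspFormLFunctionAnalyticRankProofs

/-!
# BirchSwinnertonDyer / PAdicOrderV2 — crux `PAdicOrderThesisR2` (stmt-0487), line `Sketch`:
# the analytic-rank-1 case of stub `stub_UB_pos` reduces, prime by prime, to the non-vanishing
# of one cyclotomic `p`-adic height (Perrin-Riou's `p`-adic Gross–Zagier formula)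

`stub_UB_pos` (open) asks, for `E/ℚ` of positive analytic rank, for ONE good ordinary prime
`p ≥ 5` with `ord_{T=0} L_p(f, α_p, T) ≤ r_an(E)` for every newform `f` of `E`. In analytic rank
one this file pins down what such a prime is, over `ℚ` (the catalogued barrier
`Literature.Barriers.BirchSwinnertonDyer.PAdicHeightBarrier` records the comparison only for
`L_p(E/K, T)` over the Heegner field `K`; scope caveat (b) there: "the `ℚ`-side comparison … NOT
covered"):

* `order_padicLFunction_le_one_of_height_ne_zero` — relative to the named fact
  `perrinRiou_padicGrossZagier` (Perrin-Riou 1987, Thm. 1.3): under its hypotheses (`p ≥ 5` good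
  ordinary, `K` imaginary quadratic with odd `d_K` coprime to `N = N_E`, Heegner hypothesis,
  `p` split in `K`, `DK` the canonical cyclotomic `p`-adic height on `E(K)`, `P_K` a Heegner
  point), if `⟨P_K, P_K⟩_p ≠ 0` then `ord_{T=0} L_p(f, α_p, T) ≤ 1` for THE `ℚ`-SIDE unit-root
  `p`-adic `L`-function of `E`: indeed `L_p(E/K, T) = L_p(f, α_p, T) · L_p(g, α', T)` by
  definition (`padicLFunctionEK`), so `ord L_p(f, α_p) ≤ ord L_p(E/K) = 1`
  (`perrinRiou_padicGrossZagier.order_eq_one_iff`, `PowerSeries.le_order_mul`).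
* `order_padicLFunction_eq_one_of_height_ne_zero` — if moreover `r_an(E) ≠ 0` then
  `ord_{T=0} L_p(f, α_p, T) = 1`, the lower bound being interpolation
  (`one_le_order_padicLFunction_of_analyticRank_ne_zero` in `…StubUBRank0.lean`; private copy here): the
  conclusion of route crux #5 `PAdicOrderRankOneR4` at `(E, p, f)`, from a weak-Schneider datum at
  `p`.
* `stub_UB_pos_rank1_of_height_ne_zero` — the `stub_UB_pos`-shaped corollary for a curve of
  analytic rank `1`: a good ordinary `p ≥ 5` carrying such a datum with `⟨P_K, P_K⟩_p ≠ 0` is a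
  witness prime (`ord_T L_p ≤ r_an`) for every newform of `E` (newforms of `E` are unique,
  `IsNewformOf.unique`, but the statement is per `f` as in the stub).

So in rank one `stub_UB_pos` is EXACTLY "some good ordinary split prime `p ≥ 5` of some Heegner
field is not `P_K`-isotropic for the canonical cyclotomic height" — weak rank-one Schneider at one
prime (open for non-CM `E`: Mazur–Stein–Tate 2006, Conj. 1.1; Bertrand 1982 for CM `E`), modulo
Perrin-Riou's theorem. Nothing here is asserted: `perrinRiou_padicGrossZagier` is a hypothesis.
-/

-- single-conjunct summit: `Summit.BirchSwinnertonDyer.BirchSwinnertonDyer.…` repeats the name by design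
set_option linter.dupNamespace false

namespace Summit.BirchSwinnertonDyer.BirchSwinnertonDyer.Cruxes.PAdicOrderThesisR2.KatoSandwich

open scoped MatrixGroups ModularForm
open CongruenceSubgroup NumberField
open Literature.NumberTheory.EllipticCurves Literature.NumberTheory.EllipticCurves.ModularForms

/-- **`⟨P_K, P_K⟩_p ≠ 0 ⇒ ord_{T=0} L_p(E, T) ≤ 1` over `ℚ`**, relative to Perrin-Riou's `p`-adic
Gross–Zagier formula (`h : perrinRiou_padicGrossZagier`; Perrin-Riou 1987, Thm. 1.3). Hypotheses as
in that fact: `E/ℚ` (globally minimal `W`) of conductor `N`, newforms `f` of `E` and `g` of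
`E^{(d_K)}`, `p ≥ 5` good ordinary, `K` imaginary quadratic with odd `d_K` coprime to `N`
satisfying the Heegner hypothesis, `p` split in `K`, `DK` the canonical cyclotomic `p`-adic height
on `E(K)`, `P` a Heegner point of level `N`. If `DK.height P ≠ 0` then `L_p(E/K, T)` has a simple
zero at `T = 0` (`perrinRiou_padicGrossZagier.order_eq_one_iff`), and since
`L_p(E/K, T) = L_p(f, α_p, T) · L_p(g, α', T)` (`padicLFunctionEK`, by definition) the first factor
has order `≤ 1` (`PowerSeries.le_order_mul`). Greenberg, LNM 1716, §4 (p. 111): "Perrin-Riou's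
result asserts that `L_p(E/ℚ, s)` also has a simple zero at `s = 1`" when `h_p(P) ≠ 0`.
[cite: PerrinRiou1987, Thm. 1.3] -/
theorem order_padicLFunction_le_one_of_height_ne_zero (h : perrinRiou_padicGrossZagier)
    {W : WeierstrassCurve ℚ} [W.IsElliptic] [W.IsGloballyMinimal] {p : ℕ} [Fact p.Prime]
    {K : Type} [Field K] [NumberField K] {N : ℕ} [NeZero N]
    {Nf Ng : ℕ} [NeZero Nf] [NeZero Ng] {f : CuspForm (Gamma0 Nf) 2} {g : CuspForm (Gamma0 Ng) 2}
    (hf : IsNewformOf W f) (hg : IsNewformOf (W.quadraticTwist (NumberField.discr K : ℚ)) g)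
    (hp : 5 ≤ p) (hgood : W.HasGoodReductionAtPrime p) (hord : ¬ (p : ℤ) ∣ W.frobeniusTrace p)
    (hK : IsImaginaryQuadratic K) (hodd : Odd (NumberField.discr K))
    (hcop : IsCoprime (NumberField.discr K) (N : ℤ)) (hN : W.conductorNorm ℤ = N)
    (hH : SatisfiesHeegnerHypothesis N K)
    (hsplit : ((Ideal.span {(p : ℤ)}).primesOver (𝓞 K)).ncard = 2)
    {DK : WeierstrassCurve.PAdicHeightDataK W p K} (hDK : DK.IsCanonical)
    {P : (W.baseChange K).toAffine.Point} (hP : IsHeegnerPoint N W K P) (hh : DK.height P ≠ 0) :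
    (padicLFunction f (unitRoot W p : ℚ_[p])).order ≤ 1 := by
  have h1 : (padicLFunctionEK W p K hf hg).order = 1 :=
    (h.order_eq_one_iff hf hg hp hgood hord hK hodd hcop hN hH hsplit hDK hP).mpr hh
  have hle : (padicLFunction f (unitRoot W p : ℚ_[p])).order +
      (padicLFunction g (twistUnitRoot W p K)).order ≤ (padicLFunctionEK W p K hf hg).order :=
    PowerSeries.le_order_mul _ _
  rw [h1] at hle
  exact le_self_add.trans hle

/-- `r_an(E) ≠ 0 ⇒ ord_{T=0} L_p(E, T) ≥ 1` at a good ordinary prime (interpolation: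
`L_p(E, 0) = (1 - α⁻¹)² [0]⁺_f`, `isPAdicLFunctionOf_padicLFunction_holds`, and `[0]⁺_f = 0` when
`L(E, 1) = 0`, `ratPlusSymbol_zero_eq_zero_of_entireLFunction_eq_zero`; Mazur–Tate–Teitelbaum 1986,
(14.3)). Local copy of `one_le_order_padicLFunction_of_analyticRank_ne_zero`
(`Theorems/PAdicOrderV2PAdicOrderThesisR2StubUBRank0.lean`), kept private so that this file does not
depend on that module. [cite: MazurTateTeitelbaum1986Invent, §I.14 (14.3)] -/
private theorem one_le_order_of_analyticRank_ne_zero {W : WeierstrassCurve ℚ} [W.IsElliptic]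
    [W.IsGloballyMinimal] {p : ℕ} [Fact p.Prime] (hord : IsOrdinaryAt W p)
    {N : ℕ} [NeZero N] {f : CuspForm (Gamma0 N) 2} (hf : IsNewformOf W f) (hr : W.analyticRank ≠ 0) :
    (1 : ℕ∞) ≤ (padicLFunction f (unitRoot W p : ℚ_[p])).order := by
  have hL : W.entireLFunction 1 = 0 := by
    by_contra hne
    exact hr ((W.analyticRank_eq_zero_iff_holds hf.hasEntireLFunction).mpr hne)
  refine PowerSeries.nat_le_order _ 1 fun i hi ↦ ?_
  obtain rfl : i = 0 := by omega
  rw [PowerSeries.coeff_zero_eq_constantCoeff_apply, (isPAdicLFunctionOf_padicLFunction_holds hord hf).1,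
    ratPlusSymbol_zero_eq_zero_of_entireLFunction_eq_zero hf hL, Rat.cast_zero, mul_zero]

/-- **`⟨P_K, P_K⟩_p ≠ 0 ⇒ ord_{T=0} L_p(E, T) = 1` in positive analytic rank** (the conclusion of
route crux #5 `PAdicOrderRankOneR4` at `(E, p, f)`, from a weak-Schneider datum at `p`): under the
hypotheses of `order_padicLFunction_le_one_of_height_ne_zero`, if moreover `r_an(E) ≠ 0` then
`ord_{T=0} L_p(f, α_p, T) = 1`, the lower bound `≥ 1` being interpolation
(`L(E, 1) = 0 ⇒ L_p(E, 0) = 0`,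
Mazur–Tate–Teitelbaum 1986, (14.3)) and the upper bound Perrin-Riou 1987, Thm. 1.3 (hypothesis `h`).
[cite: PerrinRiou1987, Thm. 1.3] -/
theorem order_padicLFunction_eq_one_of_height_ne_zero (h : perrinRiou_padicGrossZagier)
    {W : WeierstrassCurve ℚ} [W.IsElliptic] [W.IsGloballyMinimal] {p : ℕ} [Fact p.Prime]
    {K : Type} [Field K] [NumberField K] {N : ℕ} [NeZero N]
    {Nf Ng : ℕ} [NeZero Nf] [NeZero Ng] {f : CuspForm (Gamma0 Nf) 2} {g : CuspForm (Gamma0 Ng) 2}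
    (hf : IsNewformOf W f) (hg : IsNewformOf (W.quadraticTwist (NumberField.discr K : ℚ)) g)
    (hp : 5 ≤ p) (hgood : W.HasGoodReductionAtPrime p) (hord : ¬ (p : ℤ) ∣ W.frobeniusTrace p)
    (hK : IsImaginaryQuadratic K) (hodd : Odd (NumberField.discr K))
    (hcop : IsCoprime (NumberField.discr K) (N : ℤ)) (hN : W.conductorNorm ℤ = N)
    (hH : SatisfiesHeegnerHypothesis N K)
    (hsplit : ((Ideal.span {(p : ℤ)}).primesOver (𝓞 K)).ncard = 2)
    {DK : WeierstrassCurve.PAdicHeightDataK W p K} (hDK : DK.IsCanonical)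
    {P : (W.baseChange K).toAffine.Point} (hP : IsHeegnerPoint N W K P) (hh : DK.height P ≠ 0)
    (hr : W.analyticRank ≠ 0) :
    (padicLFunction f (unitRoot W p : ℚ_[p])).order = 1 :=
  le_antisymm
    (order_padicLFunction_le_one_of_height_ne_zero h hf hg hp hgood hord hK hodd hcop hN hH hsplit
      hDK hP hh)
    (one_le_order_of_analyticRank_ne_zero ⟨hgood, hord⟩ hf hr)

/-- **Rank-one case of `stub_UB_pos` from a weak-Schneider datum at one prime.** Let `E/ℚ`
(globally minimal `W`) have analytic rank `1` and conductor `N`, and suppose given, relative to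
Perrin-Riou's `p`-adic Gross–Zagier formula (`h`), a good ordinary prime `p ≥ 5`, an imaginary
quadratic `K` (odd `d_K` coprime to `N`, Heegner hypothesis, `p` split), the newform `g` of
`E^{(d_K)}`, the canonical cyclotomic height `DK` on `E(K)` and a Heegner point `P` of level `N`
with `⟨P, P⟩_p ≠ 0`. Then `p` is a witness prime for `stub_UB_pos`: `5 ≤ p`, `p` is good ordinary,
and `ord_{T=0} L_p(f, α_p, T) ≤ r_an(E)` for EVERY newform `f` of `E`
(`order_padicLFunction_le_one_of_height_ne_zero` applied to `f`; Perrin-Riou 1987, Thm. 1.3). So in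
analytic rank one the open stub is weak rank-one Schneider at one prime (Mazur–Stein–Tate 2006,
Conj. 1.1, asks non-degeneracy at every `p`). [cite: PerrinRiou1987, Thm. 1.3] -/
theorem stub_UB_pos_rank1_of_height_ne_zero :
    Literature.NumberTheory.EllipticCurves.perrinRiou_padicGrossZagier →
      ∀ (W : WeierstrassCurve ℚ) [W.IsElliptic] [W.IsGloballyMinimal], W.analyticRank = 1 →
      ∀ (p : ℕ) [Fact p.Prime], 5 ≤ p → W.HasGoodReductionAtPrime p → ¬ (p : ℤ) ∣ W.frobeniusTrace p →
      ∀ (K : Type) [Field K] [NumberField K] (N : ℕ) [NeZero N] {Ng : ℕ} [NeZero Ng]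
        {g : CuspForm (CongruenceSubgroup.Gamma0 Ng) 2},
      Literature.NumberTheory.EllipticCurves.ModularForms.IsNewformOf
          (W.quadraticTwist (NumberField.discr K : ℚ)) g →
      Literature.NumberTheory.EllipticCurves.IsImaginaryQuadratic K → Odd (NumberField.discr K) →
      IsCoprime (NumberField.discr K) (N : ℤ) → W.conductorNorm ℤ = N →
      Literature.NumberTheory.EllipticCurves.SatisfiesHeegnerHypothesis N K →
      ((Ideal.span {(p : ℤ)}).primesOver (NumberField.RingOfIntegers K)).ncard = 2 →
      ∀ {DK : WeierstrassCurve.PAdicHeightDataK W p K}, DK.IsCanonical →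
      ∀ {P : (W.baseChange K).toAffine.Point},
        Literature.NumberTheory.EllipticCurves.IsHeegnerPoint N W K P → DK.height P ≠ 0 →
      ∃ (p : ℕ) (_ : Fact p.Prime), 5 ≤ p ∧ Literature.NumberTheory.EllipticCurves.IsOrdinaryAt W p ∧
        ∀ {N : ℕ} [NeZero N] (f : CuspForm (CongruenceSubgroup.Gamma0 N) 2),
          Literature.NumberTheory.EllipticCurves.ModularForms.IsNewformOf W f →
            (Literature.NumberTheory.EllipticCurves.padicLFunction f
              (Literature.NumberTheory.EllipticCurves.unitRoot W p : ℚ_[p])).order ≤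
              (W.analyticRank : ℕ∞) := by
  intro h W _ _ hr p _ hp hgood hord K _ _ N _ Ng _ g hg hK hodd hcop hN hH hsplit DK hDK P hP hh
  refine ⟨p, inferInstance, hp, ⟨hgood, hord⟩, fun f hf ↦ ?_⟩
  rw [hr, Nat.cast_one]
  exact order_padicLFunction_le_one_of_height_ne_zero h hf hg hp hgood hord hK hodd hcop hN hH hsplit
    hDK hP hh

end Summit.BirchSwinnertonDyer.BirchSwinnertonDyer.Cruxes.PAdicOrderThesisR2.KatoSandwich
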